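import Mathlib
import Summits.KontsevichZagierPeriods.KontsevichZagierPeriods.Theorems.SoloInformedNashSimplex
import Summits.KontsevichZagierPeriods.KontsevichZagierPeriods.Theorems.SoloInformedCubulationOne
import HarnessLib

/-!
# SoloInformed — the first rung of the Nash triangulation statement (m = 1)

In dimension one the ordered simplex is the cube: `∇¹ = (0,1)`, its closure `[0,1]`. Hence a cubulation
datum is a triangulation datum (`SoloInformedCubulation.toTriangulationOne`) and the proved rung
`soloInformed_nashCubulation_one` gives `SoloInformedNashTriangulation` for `m = 1`
(`soloInformed_nashTriangulation_one`): every `ℚ`-semialgebraic `K ⊆ [0,1]` admits a Nash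
triangulation datum. This is the BC5-type witness for the obligation `SoloInformedNashTriangulation`.
-/

noncomputable section

open Set MeasureTheory
open Literature.ModelTheory.ExponentialFields Literature.NumberTheory.Transcendental

namespace Summit.KontsevichZagierPeriods.KontsevichZagierPeriods.Theorems

/-- In dimension one the open ordered simplex is the open cube. -/
theorem soloInformedOrdSimplex_one : soloInformedOrdSimplex 1 = soloInformedOpenCube 1 := by
  ext t
  simp only [soloInformedOrdSimplex, mem_setOf_eq, soloInformed_mem_openCube_iff]
  exact ⟨fun h => h.1, fun h => ⟨h, fun i j hij => absurd hij (by
    have hi := Subsingleton.elim i j; simp [hi])⟩⟩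

/-- In dimension one the closed ordered simplex is the closed cube. -/
theorem soloInformedOrdSimplexC_one : soloInformedOrdSimplexC 1 = soloInformedCube 1 := by
  ext t
  simp only [soloInformedOrdSimplexC, mem_setOf_eq, soloInformed_mem_cube_iff]
  exact ⟨fun h => h.1, fun h => ⟨h, fun i j _ => by rw [Subsingleton.elim i j]⟩⟩

/-- **A cubulation datum in dimension one is a triangulation datum.** -/
def SoloInformedCubulation.toTriangulationOne {K : Set (Fin 1 → ℝ)}
    (C : SoloInformedCubulation K) : SoloInformedTriangulation K where
  k := C.k
  σ := C.Φ
  σ' := C.Φ'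
  H i := (C.G i).toGermOn.mono soloInformedOrdSimplexC_one.subset
  semialgebraic i := by rw [soloInformedOrdSimplex_one]; exact C.semialgebraic i
  hasFDerivWithinAt i := by rw [soloInformedOrdSimplex_one]; exact C.hasFDerivWithinAt i
  injOn i := by rw [soloInformedOrdSimplex_one]; exact C.injOn i
  subset i := by rw [soloInformedOrdSimplex_one]; exact C.subset i
  almostDisjoint i j hij := by rw [soloInformedOrdSimplex_one]; exact C.almostDisjoint i j hij
  cover := by simp_rw [soloInformedOrdSimplex_one]; exact C.cover
  jacobian i t ht := by
    rw [soloInformedOrdSimplex_one] at ht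
    simpa using C.jacobian i t ht

/-- **First rung of `SoloInformedNashTriangulation` (m = 1), proved**: every `ℚ`-semialgebraic
`K ⊆ [0,1]` admits a Nash triangulation datum. -/
theorem soloInformed_nashTriangulation_one (K : Set (Fin 1 → ℝ)) (hK : IsSemialgebraic ℚ K)
    (hKc : K ⊆ soloInformedCube 1) : Nonempty (SoloInformedTriangulation K) :=
  let ⟨D⟩ := soloInformed_nashCubulation_one K hK hKc
  ⟨D.toTriangulationOne⟩

end Summit.KontsevichZagierPeriods.KontsevichZagierPeriods.Theorems
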